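import Summits.Ventures.CertifiedQuantumChemistry.Certificates.HubbardRingL4LiftGMapRows
import HarnessLib

/-!
# Ventures/CertifiedQuantumChemistry — Certificates/HubbardRingL4LiftFeasible.lean: LAYER 2 of the L = 4 lift assembly —
# the exact lift FAMILY `(γ(ε, δ), Γ(ε, δ))` is `(2,2)`-sector-DQG-feasible (4-ring) for `0 ≤ δ ≤ 1`, `ε = η²`,
# `0 ≤ η ≤ 1`, `1156·η ≤ δ` — i.e. at every `U = 1/ε ≥ (1156/δ)²`

HONEST FRAMING (verbatim): certified bounds for a stated model Hamiltonian in a stated basis; not a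
claim about the real molecule beyond that model. Auxiliary objects only; no model energy is bounded in THIS file
(the energy and the plateau floor are `…LiftPlateauFloor.lean`).

Seat rdm-B (gen 42; the assembly announced in `tools/x14-g41/NOTES-session.md` «L2 ASSEMBLY SPEC»). THE OBJECT: the
two-parameter family `(γ(ε, δ), Γ(ε, δ)) = Σ_{j ≤ 2, k ≤ 1} ε^j δ^k (γ_jk, Γ_jk)` of PAIR-valued (`ℚ(√2)` as rational pairs,
`Rows/SqrtTwoFactorPSD.lean`) coefficient tables of `Certificates/HubbardRingL4LiftPairPSD.lean` — the Lean-convention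
form of the seat's EXACT F-5c lift `ab-files/v39/lift_L4_DQG.json` (gen 23; STRUCTURE §2.2.14, until now words +
exact-certificate grade), re-derived independently by `tools/x14-g41/liftpencil.py`; NO SDP solver anywhere.

WHAT IS PROVED (by LINEARITY from kernel facts already in the tree; this file runs no large `decide`):
* §1 `liftGamC ε δ`, `liftGGC ε δ` — the family as complex matrices with real entries `liftGamR`, `liftGGR`; the
  Literature maps over `ℝ` (`qMapR`, `gMapR`, verbatim formulas) with `qMap_ofReal` / `gMap_ofReal`;
* §2 the three POSITIVITY conditions over `ℂ` for `0 ≤ δ ≤ 1`, `0 ≤ η ≤ 1`: `Γ(η², δ) ⪰ 0` and `Q ⪰ 0` (`125·η ≤ δ`),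
  `G ⪰ 0` (`1156·η ≤ δ`) — LAYER 1 (`realGG_posSemidef`, `realQQ_posSemidef`, `realGm_posSemidef`: all nine symmetry
  blocks certified along the family by `Rows/PencilBlockCertificate.lean`) carried to `qMap`/`gMap` OF THE FAMILY through
  the coefficient identities `Q_jk = qMapP (γ_jk, Γ_jk)` (`…LiftCoeffRows` §2), `G_jk = gMapP (γ_jk, Γ_jk)`
  (`…LiftGMapRows`) and affinity/linearity of the maps (the `Q`-map's constant rides on the coefficient `(0,0)`, weight
  `ε⁰δ⁰ = 1`; Kronecker symbols become real atoms `kd`, so each bridge is ONE polynomial identity closed by `ring`),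
  then complexified (`DQGGap.posSemidef_map_ofReal`) and re-indexed (`DQGGap.ePair`);
* §3 every LINEAR row of `IsDQGFeasibleSector 2 2` (Hermiticity, `S_z` selection, traces `2, 2`, contraction onto `3γ`,
  antisymmetries, block traces `2, 2, 4`) from the coefficientwise kernel rows `liftGam_rows` / `liftGG_rows`
  (`…LiftCoeffRows` §3) by exchanging finite sums; hence **`lift_isDQGFeasibleSector`**.
NOT a row of `CERTIFIED.md`, no claim node; S-U UNTOUCHED. 0 sorry; seven small `def`s (`liftGamR`, `liftGGR`,
`liftGamC`, `liftGGC`, `qMapR`, `gMapR`, `kd`), standard axioms. References (docstring-only): D. A. Mazziotti, Adv. Chem.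
Phys. 134 (2007) ch. 3 §II.B eqs. (11)–(17), §II.F; M. Nakata et al., J. Chem. Phys. 128 (2008) 164113 §II.C.
-/

set_option linter.style.longLine false

namespace Summit.Ventures.CertifiedQuantumChemistry

namespace LiftL4

open Matrix Finset SqrtTwo DQGGap
open Literature.MathematicalPhysics.QuantumLattice Literature.MathematicalPhysics.QuantumChemistry
open Summit.Ventures.CertifiedQuantumChemistry.Hamiltonians
open scoped ComplexOrder

/-! ## §1 The family as real and complex matrices -/

/-- The real one-matrix family of the lift: `γ(ε, δ)_{xy} = Σ_{j,k} ε^j δ^k · γ_jk(x, y)` (`ε = 1/U`). -/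
noncomputable def liftGamR (ε δ : ℝ) (x y : Orb (Fin 4)) : ℝ :=
  ∑ j : Fin 3, ∑ k : Fin 2, ε ^ (j : ℕ) * δ ^ (k : ℕ) * toReal (gamP (liftGam j k) x y)

/-- The real two-matrix family of the lift on ordered pairs: `Γ(ε, δ)_{PR} = Σ_{j,k} ε^j δ^k · Γ_jk(P, R)`. -/
noncomputable def liftGGR (ε δ : ℝ) (P R : Orb (Fin 4) × Orb (Fin 4)) : ℝ :=
  ∑ j : Fin 3, ∑ k : Fin 2, ε ^ (j : ℕ) * δ ^ (k : ℕ) * toReal (GamP (liftGG j k) P R)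

/-- The lift family's one-matrix as a complex matrix (real entries). -/
noncomputable def liftGamC (ε δ : ℝ) : Matrix (Orb (Fin 4)) (Orb (Fin 4)) ℂ :=
  fun x y => ((liftGamR ε δ x y : ℝ) : ℂ)

/-- The lift family's two-matrix as a complex matrix (real entries). -/
noncomputable def liftGGC (ε δ : ℝ) : Matrix (Orb (Fin 4) × Orb (Fin 4)) (Orb (Fin 4) × Orb (Fin 4)) ℂ :=
  fun P R => ((liftGGR ε δ P R : ℝ) : ℂ)

/-- Mazziotti's `Q`-map written over `ℝ` (the Literature's `qMap` formula, verbatim). -/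
noncomputable def qMapR {ι : Type*} [DecidableEq ι] (γ : ι → ι → ℝ) (Γ : ι × ι → ι × ι → ℝ) (p q : ι × ι) : ℝ :=
  ((if p.1 = q.1 then (1 : ℝ) else 0) * (if p.2 = q.2 then (1 : ℝ) else 0) -
      (if p.1 = q.2 then (1 : ℝ) else 0) * (if p.2 = q.1 then (1 : ℝ) else 0)) -
    (if p.2 = q.2 then (1 : ℝ) else 0) * γ q.1 p.1 + (if p.2 = q.1 then (1 : ℝ) else 0) * γ q.2 p.1 +
    (if p.1 = q.2 then (1 : ℝ) else 0) * γ q.1 p.2 - (if p.1 = q.1 then (1 : ℝ) else 0) * γ q.2 p.2 +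
    Γ q p

/-- Mazziotti's `G`-map written over `ℝ` (the Literature's `gMap` formula, verbatim). -/
noncomputable def gMapR {ι : Type*} [DecidableEq ι] (γ : ι → ι → ℝ) (Γ : ι × ι → ι × ι → ℝ) (p q : ι × ι) : ℝ :=
  (if p.2 = q.2 then γ p.1 q.1 else 0) - Γ (p.1, q.2) (q.1, p.2)

/-- The Literature's `qMap` of a real pair is the cast of `qMapR`. -/
theorem qMap_ofReal {ι : Type*} [LinearOrder ι] [Fintype ι] (γ : ι → ι → ℝ) (Γ : ι × ι → ι × ι → ℝ) :
    qMap (fun i j => ((γ i j : ℝ) : ℂ)) (fun P R => ((Γ P R : ℝ) : ℂ)) = fun p q => ((qMapR γ Γ p q : ℝ) : ℂ) := by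
  funext p q
  simp only [qMap, qMapR, Complex.ofReal_add, Complex.ofReal_sub, Complex.ofReal_mul, apply_ite Complex.ofReal,
    Complex.ofReal_one, Complex.ofReal_zero]

/-- The Literature's `gMap` of a real pair is the cast of `gMapR`. -/
theorem gMap_ofReal {ι : Type*} [LinearOrder ι] [Fintype ι] (γ : ι → ι → ℝ) (Γ : ι × ι → ι × ι → ℝ) :
    gMap (fun i j => ((γ i j : ℝ) : ℂ)) (fun P R => ((Γ P R : ℝ) : ℂ)) = fun p q => ((gMapR γ Γ p q : ℝ) : ℂ) := by
  funext p q
  simp only [gMap, gMapR, Complex.ofReal_sub, apply_ite Complex.ofReal, Complex.ofReal_zero]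

/-- The Kronecker symbol as a real number (turns the `Q`-map identities into polynomial identities). -/
noncomputable def kd {ι : Type*} [DecidableEq ι] (a b : ι) : ℝ := if a = b then 1 else 0

/-- `if a = b then x else 0 = δ_{ab} · x`. -/
theorem ite_eq_kd_mul {ι : Type*} [DecidableEq ι] (a b : ι) (x : ℝ) : (if a = b then x else 0) = kd a b * x := by
  unfold kd
  split_ifs <;> simp

/-! ## §2 The three positivity conditions along the family (from layer 1) -/

/-- `Γ(ε, δ)` on pairs is the landed `realGG` re-indexed. -/
theorem realGG_ePair (ε δ : ℝ) (P R : Orb (Fin 4) × Orb (Fin 4)) : realGG ε δ (ePair P) (ePair R) = liftGGR ε δ P R := by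
  simp only [realGG, liftGGR, Matrix.sum_apply, Matrix.smul_apply, Matrix.of_apply, smul_eq_mul, toFinP,
    Equiv.symm_apply_apply]

/-- The complex two-matrix of the family is the complexification of `realGG`, re-indexed to ordered pairs. -/
theorem liftGGC_eq (ε δ : ℝ) : liftGGC ε δ = ((realGG ε δ).map Complex.ofRealHom).submatrix ePair ePair := by
  ext P R
  simp only [liftGGC, Matrix.submatrix_apply, Matrix.map_apply, Complex.ofRealHom_eq_coe, realGG_ePair]

/-- `toReal` through the pair-valued `Q`-map. -/
theorem toReal_qMapP (c : Bool) (γ : Orb (Fin 4) → Orb (Fin 4) → ℚ × ℚ)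
    (Γ : Orb (Fin 4) × Orb (Fin 4) → Orb (Fin 4) × Orb (Fin 4) → ℚ × ℚ) (p q : Orb (Fin 4) × Orb (Fin 4)) :
    toReal (qMapP c γ Γ p q) =
      (if c then ((if p.1 = q.1 ∧ p.2 = q.2 then (1 : ℝ) else 0) - (if p.1 = q.2 ∧ p.2 = q.1 then (1 : ℝ) else 0)) else 0) -
        (if p.2 = q.2 then toReal (γ q.1 p.1) else 0) + (if p.2 = q.1 then toReal (γ q.2 p.1) else 0) +
        (if p.1 = q.2 then toReal (γ q.1 p.2) else 0) - (if p.1 = q.1 then toReal (γ q.2 p.2) else 0) + toReal (Γ q p) := by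
  unfold qMapP
  simp only [toReal_add, toReal_sub, apply_ite toReal, toReal_zero, toReal_mk, Rat.cast_one, Rat.cast_zero, zero_mul,
    add_zero]

/-- `toReal` through the pair-valued `G`-map. -/
theorem toReal_gMapP (γ : Orb (Fin 4) → Orb (Fin 4) → ℚ × ℚ)
    (Γ : Orb (Fin 4) × Orb (Fin 4) → Orb (Fin 4) × Orb (Fin 4) → ℚ × ℚ) (p q : Orb (Fin 4) × Orb (Fin 4)) :
    toReal (gMapP γ Γ p q) = (if p.2 = q.2 then toReal (γ p.1 q.1) else 0) - toReal (Γ (p.1, q.2) (q.1, p.2)) := by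
  unfold gMapP
  simp only [toReal_sub, apply_ite toReal, toReal_zero]

/-- **`Q(ε, δ)` is the real `Q`-map of the family** (the landed coefficient identities `Q_jk = qMapP (γ_jk, Γ_jk)` and
linearity in the weights `ε^j δ^k`; the affine constant rides on the coefficient `(0,0)` of weight `1`). -/
theorem realQQ_ePair (ε δ : ℝ) (P R : Orb (Fin 4) × Orb (Fin 4)) :
    realQQ ε δ (ePair P) (ePair R) = qMapR (liftGamR ε δ) (liftGGR ε δ) P R := by
  -- stage 1: expand the coefficient sum and insert the landed identities `Q_jk = qMapP (γ_jk, Γ_jk)`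
  simp only [realQQ, Matrix.sum_apply, Matrix.add_apply, Matrix.smul_apply, Matrix.of_apply, smul_eq_mul,
    Fin.sum_univ_three, Fin.sum_univ_two, Fin.isValue, liftQQ_eq_qMapP00, liftQQ_eq_qMapP01, liftQQ_eq_qMapP10,
    liftQQ_eq_qMapP11, liftQQ_eq_qMapP20, liftQQ_eq_qMapP21]
  -- stage 2: evaluate both sides as polynomials in the Kronecker symbols and the table entries
  simp only [toFinP, Equiv.symm_apply_apply, toReal_qMapP, liftGamR, liftGGR, qMapR, Fin.sum_univ_three,
    Fin.sum_univ_two, Fin.isValue, Fin.val_zero, Fin.val_one, Fin.val_two, pow_zero, pow_one, one_mul, mul_one,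
    if_true, Bool.false_eq_true, if_false, zero_sub]
  -- stage 3: Kronecker symbols as real atoms; one polynomial identity
  simp only [ite_and, ite_eq_kd_mul]
  ring

/-- **`G(ε, δ)` is the real `G`-map of the family** (coefficient identities `G_jk = gMapP (γ_jk, Γ_jk)`, linearity). -/
theorem realGm_ePair (ε δ : ℝ) (P R : Orb (Fin 4) × Orb (Fin 4)) :
    realGm ε δ (ePair P) (ePair R) = gMapR (liftGamR ε δ) (liftGGR ε δ) P R := by
  simp only [realGm, Matrix.sum_apply, Matrix.smul_apply, Matrix.of_apply, smul_eq_mul, liftGm_eq_gMapP]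
  simp only [toFinP, Equiv.symm_apply_apply, toReal_gMapP, liftGamR, liftGGR, gMapR, Fin.sum_univ_three,
    Fin.sum_univ_two, Fin.isValue, Fin.val_zero, Fin.val_one, Fin.val_two, pow_zero, pow_one, one_mul, mul_one]
  split_ifs <;> ring

/-- The `Q`-matrix of the complex family is the complexification of `realQQ`, re-indexed. -/
theorem qMap_liftC_eq (ε δ : ℝ) :
    qMap (liftGamC ε δ) (liftGGC ε δ) = ((realQQ ε δ).map Complex.ofRealHom).submatrix ePair ePair := by
  change qMap (fun i j => ((liftGamR ε δ i j : ℝ) : ℂ)) (fun P R => ((liftGGR ε δ P R : ℝ) : ℂ)) = _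
  rw [qMap_ofReal]
  ext P R
  simp only [Matrix.submatrix_apply, Matrix.map_apply, Complex.ofRealHom_eq_coe, realQQ_ePair]

/-- The `G`-matrix of the complex family is the complexification of `realGm`, re-indexed. -/
theorem gMap_liftC_eq (ε δ : ℝ) :
    gMap (liftGamC ε δ) (liftGGC ε δ) = ((realGm ε δ).map Complex.ofRealHom).submatrix ePair ePair := by
  change gMap (fun i j => ((liftGamR ε δ i j : ℝ) : ℂ)) (fun P R => ((liftGGR ε δ P R : ℝ) : ℂ)) = _
  rw [gMap_ofReal]
  ext P R
  simp only [Matrix.submatrix_apply, Matrix.map_apply, Complex.ofRealHom_eq_coe, realGm_ePair]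

/-- **D-condition of the family**: `Γ(η², δ) ⪰ 0` over `ℂ` for `0 ≤ δ ≤ 1`, `0 ≤ η ≤ 1`, `125·η ≤ δ`. -/
theorem liftGGC_posSemidef {δ η : ℝ} (hδ0 : 0 ≤ δ) (hδ1 : δ ≤ 1) (hη0 : 0 ≤ η) (hη1 : η ≤ 1) (hηδ : 125 * η ≤ δ) :
    (liftGGC (η ^ 2) δ).PosSemidef := by
  rw [liftGGC_eq]
  exact (posSemidef_map_ofReal (realGG_posSemidef hδ0 hδ1 hη0 hη1 hηδ)).submatrix ePair

/-- **Q-condition of the family**: `Q(γ(η², δ), Γ(η², δ)) ⪰ 0` over `ℂ` for `0 ≤ δ ≤ 1`, `0 ≤ η ≤ 1`, `125·η ≤ δ`. -/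
theorem qMap_liftC_posSemidef {δ η : ℝ} (hδ0 : 0 ≤ δ) (hδ1 : δ ≤ 1) (hη0 : 0 ≤ η) (hη1 : η ≤ 1) (hηδ : 125 * η ≤ δ) :
    (qMap (liftGamC (η ^ 2) δ) (liftGGC (η ^ 2) δ)).PosSemidef := by
  rw [qMap_liftC_eq]
  exact (posSemidef_map_ofReal (realQQ_posSemidef hδ0 hδ1 hη0 hη1 hηδ)).submatrix ePair

/-- **G-condition of the family**: `G(γ(η², δ), Γ(η², δ)) ⪰ 0` over `ℂ` for `0 ≤ δ ≤ 1`, `0 ≤ η ≤ 1`, `1156·η ≤ δ`. -/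
theorem gMap_liftC_posSemidef {δ η : ℝ} (hδ0 : 0 ≤ δ) (hδ1 : δ ≤ 1) (hη0 : 0 ≤ η) (hη1 : η ≤ 1) (hηδ : 1156 * η ≤ δ) :
    (gMap (liftGamC (η ^ 2) δ) (liftGGC (η ^ 2) δ)).PosSemidef := by
  rw [gMap_liftC_eq]
  exact (posSemidef_map_ofReal (realGm_posSemidef hδ0 hδ1 hη0 hη1 hηδ)).submatrix ePair

/-! ## §3 The linear rows along the family (from the coefficientwise kernel facts, by linearity) -/

/-- Entries of the real one-matrix family at orbitals. -/
theorem liftGamR_orb (ε δ : ℝ) (p : Fin 4) (σ : Fin 2) (q : Fin 4) (τ : Fin 2) :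
    liftGamR ε δ (orb p σ) (orb q τ) = ∑ j : Fin 3, ∑ k : Fin 2, ε ^ (j : ℕ) * δ ^ (k : ℕ) * toReal (liftGam j k p σ q τ) :=
  rfl

/-- Entries of the real two-matrix family at orbital pairs. -/
theorem liftGGR_orb (ε δ : ℝ) (p : Fin 4) (σ : Fin 2) (q : Fin 4) (τ : Fin 2) (r : Fin 4) (μ : Fin 2) (t : Fin 4)
    (ν : Fin 2) : liftGGR ε δ (orb p σ, orb q τ) (orb r μ, orb t ν) =
      ∑ j : Fin 3, ∑ k : Fin 2, ε ^ (j : ℕ) * δ ^ (k : ℕ) * toReal (liftGG j k p σ q τ r μ t ν) :=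
  rfl

/-- Linearity: a finite sum of family values is the family value of the summed coefficients. -/
theorem sum_family {α : Type*} (s : Finset α) (ε δ : ℝ) (f : Fin 3 → Fin 2 → α → ℚ × ℚ) :
    ∑ a ∈ s, ∑ j : Fin 3, ∑ k : Fin 2, ε ^ (j : ℕ) * δ ^ (k : ℕ) * toReal (f j k a) =
      ∑ j : Fin 3, ∑ k : Fin 2, ε ^ (j : ℕ) * δ ^ (k : ℕ) * toReal (∑ a ∈ s, f j k a) := by
  rw [Finset.sum_comm]
  refine Finset.sum_congr rfl fun j _ => ?_
  rw [Finset.sum_comm]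
  refine Finset.sum_congr rfl fun k _ => ?_
  rw [toReal_sum, Finset.mul_sum]

/-- Only the coefficient `(0,0)` (weight `ε⁰δ⁰ = 1`) carries affine data: `Σ_jk ε^j δ^k [jk = 00]·v = v`. -/
theorem sum_weight_flag00 (ε δ : ℝ) (v : ℚ × ℚ) :
    ∑ j : Fin 3, ∑ k : Fin 2, ε ^ (j : ℕ) * δ ^ (k : ℕ) * toReal (if (j : ℕ) = 0 ∧ (k : ℕ) = 0 then v else 0) = toReal v := by
  simp [Fin.sum_univ_three, Fin.sum_univ_two, toReal_zero]

/-- The real one-matrix family is symmetric. -/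
theorem liftGamR_symm (ε δ : ℝ) (p : Fin 4) (σ : Fin 2) (q : Fin 4) (τ : Fin 2) :
    liftGamR ε δ (orb q τ) (orb p σ) = liftGamR ε δ (orb p σ) (orb q τ) := by
  rw [liftGamR_orb, liftGamR_orb]
  refine Finset.sum_congr rfl fun j _ => Finset.sum_congr rfl fun k _ => ?_
  rw [(liftGam_rows j k).1 p σ q τ]

/-- `S_z` selection rule of the one-matrix family. -/
theorem liftGamR_spin (ε δ : ℝ) (p q : Fin 4) {σ τ : Fin 2} (h : σ ≠ τ) : liftGamR ε δ (orb p σ) (orb q τ) = 0 := by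
  rw [liftGamR_orb]
  refine Finset.sum_eq_zero fun j _ => Finset.sum_eq_zero fun k _ => ?_
  rw [(liftGam_rows j k).2.1 p q σ τ h, toReal_zero, mul_zero]

/-- Spin-up trace of the one-matrix family: `2`. -/
theorem liftGamR_trace_up (ε δ : ℝ) : ∑ x : Fin 4, liftGamR ε δ (orb x 0) (orb x 0) = 2 := by
  simp only [liftGamR_orb]
  rw [sum_family]
  simp only [fun j k => (liftGam_rows j k).2.2.1, sum_weight_flag00, toReal_mk, Rat.cast_ofNat, Rat.cast_zero, zero_mul,
    add_zero]

/-- Spin-down trace of the one-matrix family: `2`. -/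
theorem liftGamR_trace_down (ε δ : ℝ) : ∑ x : Fin 4, liftGamR ε δ (orb x 1) (orb x 1) = 2 := by
  simp only [liftGamR_orb]
  rw [sum_family]
  simp only [fun j k => (liftGam_rows j k).2.2.2, sum_weight_flag00, toReal_mk, Rat.cast_ofNat, Rat.cast_zero, zero_mul,
    add_zero]

/-- Contraction row of the two-matrix family: `Σ_{rμ} Γ(pσ rμ; qτ rμ) = 3·γ(pσ; qτ)`. -/
theorem liftGGR_contract (ε δ : ℝ) (p : Fin 4) (σ : Fin 2) (q : Fin 4) (τ : Fin 2) :
    ∑ r : Fin 4, ∑ μ : Fin 2, liftGGR ε δ (orb p σ, orb r μ) (orb q τ, orb r μ) = 3 * liftGamR ε δ (orb p σ) (orb q τ) := by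
  simp only [liftGGR_orb, liftGamR_orb]
  simp only [sum_family]
  rw [Finset.mul_sum]
  refine Finset.sum_congr rfl fun j _ => ?_
  rw [Finset.mul_sum]
  refine Finset.sum_congr rfl fun k _ => ?_
  rw [(liftGG_rows j k).1 p σ q τ, show ((3, 3) : ℚ × ℚ) = (((3 : ℚ)), ((3 : ℚ))) from rfl, toReal_signpair_mul]
  push_cast
  ring

/-- Antisymmetry of the two-matrix family in the first pair. -/
theorem liftGGR_swap_fst (ε δ : ℝ) (p : Fin 4) (σ : Fin 2) (q : Fin 4) (τ : Fin 2) (r : Fin 4) (μ : Fin 2) (t : Fin 4)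
    (ν : Fin 2) : liftGGR ε δ (orb q τ, orb p σ) (orb r μ, orb t ν) = -liftGGR ε δ (orb p σ, orb q τ) (orb r μ, orb t ν) := by
  rw [liftGGR_orb, liftGGR_orb, ← Finset.sum_neg_distrib]
  refine Finset.sum_congr rfl fun j _ => ?_
  rw [← Finset.sum_neg_distrib]
  refine Finset.sum_congr rfl fun k _ => ?_
  rw [(liftGG_rows j k).2.1, toReal_neg, mul_neg]

/-- Antisymmetry of the two-matrix family in the second pair. -/
theorem liftGGR_swap_snd (ε δ : ℝ) (p : Fin 4) (σ : Fin 2) (q : Fin 4) (τ : Fin 2) (r : Fin 4) (μ : Fin 2) (t : Fin 4)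
    (ν : Fin 2) : liftGGR ε δ (orb p σ, orb q τ) (orb t ν, orb r μ) = -liftGGR ε δ (orb p σ, orb q τ) (orb r μ, orb t ν) := by
  rw [liftGGR_orb, liftGGR_orb, ← Finset.sum_neg_distrib]
  refine Finset.sum_congr rfl fun j _ => ?_
  rw [← Finset.sum_neg_distrib]
  refine Finset.sum_congr rfl fun k _ => ?_
  rw [(liftGG_rows j k).2.2.1, toReal_neg, mul_neg]

/-- `αα` block trace of the two-matrix family: `2 = 2·(2−1)`. -/
theorem liftGGR_trace_upUp (ε δ : ℝ) : ∑ x : Fin 4, ∑ y : Fin 4, liftGGR ε δ (orb x 0, orb y 0) (orb x 0, orb y 0) = 2 := by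
  simp only [liftGGR_orb]
  simp only [sum_family]
  simp only [fun j k => (liftGG_rows j k).2.2.2.1, sum_weight_flag00, toReal_mk, Rat.cast_ofNat, Rat.cast_zero,
    zero_mul, add_zero]

/-- `ββ` block trace of the two-matrix family: `2`. -/
theorem liftGGR_trace_downDown (ε δ : ℝ) :
    ∑ x : Fin 4, ∑ y : Fin 4, liftGGR ε δ (orb x 1, orb y 1) (orb x 1, orb y 1) = 2 := by
  simp only [liftGGR_orb]
  simp only [sum_family]
  simp only [fun j k => (liftGG_rows j k).2.2.2.2.1, sum_weight_flag00, toReal_mk, Rat.cast_ofNat, Rat.cast_zero,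
    zero_mul, add_zero]

/-- `αβ` block trace of the two-matrix family: `4 = 2·2`. -/
theorem liftGGR_trace_upDown (ε δ : ℝ) :
    ∑ x : Fin 4, ∑ y : Fin 4, liftGGR ε δ (orb x 0, orb y 1) (orb x 0, orb y 1) = 4 := by
  simp only [liftGGR_orb]
  simp only [sum_family]
  simp only [fun j k => (liftGG_rows j k).2.2.2.2.2, sum_weight_flag00, toReal_mk, Rat.cast_ofNat, Rat.cast_zero,
    zero_mul, add_zero]

/-- The complex one-matrix family is Hermitian (real symmetric), for every `(ε, δ)`. -/
theorem liftGamC_isHermitian (ε δ : ℝ) : (liftGamC ε δ).IsHermitian := by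
  have hs := (toLex (α := Fin 4 × Fin 2)).surjective
  refine Matrix.IsHermitian.ext fun i j => ?_
  obtain ⟨⟨p, σ⟩, rfl⟩ := hs i
  obtain ⟨⟨q, τ⟩, rfl⟩ := hs j
  show star (((liftGamR ε δ (orb q τ) (orb p σ) : ℝ) : ℂ)) = ((liftGamR ε δ (orb p σ) (orb q τ) : ℝ) : ℂ)
  rw [Complex.star_def, Complex.conj_ofReal, liftGamR_symm]

/-- The complex two-matrix family is antisymmetric in the first pair, for every `(ε, δ)`. -/
theorem liftGGC_swap_fst (ε δ : ℝ) (i j : Orb (Fin 4)) (R : Orb (Fin 4) × Orb (Fin 4)) :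
    liftGGC ε δ (j, i) R = -liftGGC ε δ (i, j) R := by
  have hs := (toLex (α := Fin 4 × Fin 2)).surjective
  obtain ⟨⟨p, σ⟩, rfl⟩ := hs i
  obtain ⟨⟨q, τ⟩, rfl⟩ := hs j
  obtain ⟨R1, R2⟩ := R
  obtain ⟨⟨r, μ⟩, rfl⟩ := hs R1
  obtain ⟨⟨t, ν⟩, rfl⟩ := hs R2
  show ((liftGGR ε δ (orb q τ, orb p σ) (orb r μ, orb t ν) : ℝ) : ℂ) = -((liftGGR ε δ (orb p σ, orb q τ) (orb r μ, orb t ν) : ℝ) : ℂ)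
  rw [liftGGR_swap_fst, Complex.ofReal_neg]

/-- The complex two-matrix family is antisymmetric in the second pair, for every `(ε, δ)`. -/
theorem liftGGC_swap_snd (ε δ : ℝ) (P : Orb (Fin 4) × Orb (Fin 4)) (k l : Orb (Fin 4)) :
    liftGGC ε δ P (l, k) = -liftGGC ε δ P (k, l) := by
  have hs := (toLex (α := Fin 4 × Fin 2)).surjective
  obtain ⟨P1, P2⟩ := P
  obtain ⟨⟨p, σ⟩, rfl⟩ := hs P1
  obtain ⟨⟨q, τ⟩, rfl⟩ := hs P2
  obtain ⟨⟨r, μ⟩, rfl⟩ := hs k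
  obtain ⟨⟨t, ν⟩, rfl⟩ := hs l
  show ((liftGGR ε δ (orb p σ, orb q τ) (orb t ν, orb r μ) : ℝ) : ℂ) = -((liftGGR ε δ (orb p σ, orb q τ) (orb r μ, orb t ν) : ℝ) : ℂ)
  rw [liftGGR_swap_snd, Complex.ofReal_neg]

/-- **THE ROWS.** For every `(ε, δ)` the complex family satisfies every LINEAR row of `IsDQGFeasibleSector 2 2`; given the
three positivity conditions it is feasible. -/
theorem isDQGFeasibleSector_of_psd3 (ε δ : ℝ) (hD : (liftGGC ε δ).PosSemidef)
    (hQ : (qMap (liftGamC ε δ) (liftGGC ε δ)).PosSemidef) (hG : (gMap (liftGamC ε δ) (liftGGC ε δ)).PosSemidef) :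
    IsDQGFeasibleSector 2 2 (liftGamC ε δ) (liftGGC ε δ) := by
  have hs := (toLex (α := Fin 4 × Fin 2)).surjective
  have hγ : ∀ x y, liftGamC ε δ x y = ((liftGamR ε δ x y : ℝ) : ℂ) := fun _ _ => rfl
  have hΓ : ∀ P R, liftGGC ε δ P R = ((liftGGR ε δ P R : ℝ) : ℂ) := fun _ _ => rfl
  refine ⟨⟨liftGamC_isHermitian ε δ, hD, hQ, hG, ?_, ?_, liftGGC_swap_fst ε δ, liftGGC_swap_snd ε δ⟩,
    ?_, ?_, ?_, ?_, ?_, ?_⟩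
  · -- trace_one
    rw [sum_orb4]
    simp only [Fin.sum_univ_two, hγ, Finset.sum_add_distrib]
    rw [← Complex.ofReal_sum, ← Complex.ofReal_sum, liftGamR_trace_up, liftGamR_trace_down]
    norm_num
  · -- contraction
    intro i k
    obtain ⟨⟨p, σ⟩, rfl⟩ := hs i
    obtain ⟨⟨q, τ⟩, rfl⟩ := hs k
    show ∑ j, liftGGC ε δ (orb p σ, j) (orb q τ, j) = (((2 + 2 : ℕ) : ℂ) - 1) * liftGamC ε δ (orb p σ) (orb q τ)
    rw [sum_orb4]
    simp only [hΓ, hγ]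
    simp_rw [← Complex.ofReal_sum]
    rw [liftGGR_contract]
    push_cast
    ring
  · intro p q σ τ hστ
    rw [hγ, liftGamR_spin ε δ p q hστ, Complex.ofReal_zero]
  · simp only [hγ]
    rw [← Complex.ofReal_sum, liftGamR_trace_up]
    norm_num
  · simp only [hγ]
    rw [← Complex.ofReal_sum, liftGamR_trace_down]
    norm_num
  · simp only [hΓ]
    simp_rw [← Complex.ofReal_sum]
    rw [liftGGR_trace_upUp]
    norm_num
  · simp only [hΓ]
    simp_rw [← Complex.ofReal_sum]
    rw [liftGGR_trace_downDown]
    norm_num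
  · simp only [hΓ]
    simp_rw [← Complex.ofReal_sum]
    rw [liftGGR_trace_upDown]
    norm_num

/-- **THE LIFT FAMILY IS `(2,2)`-SECTOR-DQG-FEASIBLE** for `0 ≤ δ ≤ 1`, `0 ≤ η ≤ 1`, `1156·η ≤ δ` (`ε = η² = 1/U`,
i.e. for every `U ≥ (1156/δ)²`): layer 1's block certificates give `D, Q, G ⪰ 0`, §3 the linear rows. -/
theorem lift_isDQGFeasibleSector {δ η : ℝ} (hδ0 : 0 ≤ δ) (hδ1 : δ ≤ 1) (hη0 : 0 ≤ η) (hη1 : η ≤ 1) (hηδ : 1156 * η ≤ δ) :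
    IsDQGFeasibleSector 2 2 (liftGamC (η ^ 2) δ) (liftGGC (η ^ 2) δ) := by
  have h125 : 125 * η ≤ δ := by nlinarith
  exact isDQGFeasibleSector_of_psd3 (η ^ 2) δ (liftGGC_posSemidef hδ0 hδ1 hη0 hη1 h125)
    (qMap_liftC_posSemidef hδ0 hδ1 hη0 hη1 h125) (gMap_liftC_posSemidef hδ0 hδ1 hη0 hη1 hηδ)

end LiftL4

end Summit.Ventures.CertifiedQuantumChemistry
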